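import Mathlib

/-!
# Candidate proof of stub S4 `stub_littlewoodOfford` (line `free-volume-heavy-witness`, crux `WindowExtinction`,
stmt-QuantumFields-8964) — drefute gen-2 seat, attached as EVIDENCE for the lead (refuters do not land positive stubs).

Littlewood–Offord / Erdős anti-concentration for independent non-degenerate signs, by the elementary
"lazy coin" decomposition: `w_i(b) = ε + r_i(b)` with `r_i ≥ 0`, expand `∏ (ε + r_i)` over subsets `J`
(the fair part lives on `J`), bound the fair atom on `J` by the central binomial coefficient, and sum the
binomial mixture.  Pure finite combinatorics + `Real.log`/`Real.exp`; no probability theory.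
-/

open Finset
open scoped BigOperators

namespace LittlewoodOffordProof

/-! ## Counting: sign patterns with a prescribed sum -/

theorem sum_sign_eq_card (ι : Type*) [Fintype ι] (v : ι → Bool) :
    (∑ i, (if v i then (1 : ℤ) else -1)) =
      2 * ((univ.filter fun i => v i = true).card : ℤ) - Fintype.card ι := by
  have h1 : ∀ i, (if v i then (1 : ℤ) else -1) = 2 * (if v i = true then (1 : ℤ) else 0) - 1 := by
    intro i; cases v i <;> simp
  simp_rw [h1, Finset.sum_sub_distrib, ← Finset.mul_sum, Finset.sum_boole, Finset.sum_const,
    Finset.card_univ]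
  simp

theorem card_signPatterns_le (ι : Type*) [Fintype ι] [DecidableEq ι] (c : ℤ) :
    (univ.filter fun v : ι → Bool => (∑ i, (if v i then (1 : ℤ) else -1)) = c).card ≤
      (Fintype.card ι).choose (Fintype.card ι / 2) := by
  classical
  set S := univ.filter fun v : ι → Bool => (∑ i, (if v i then (1 : ℤ) else -1)) = c with hS
  let φ : (ι → Bool) → Finset ι := fun v => univ.filter fun i => v i = true
  have hinj : Function.Injective φ := by
    intro v w hvw
    funext i
    have hi : (i ∈ φ v) = (i ∈ φ w) := by rw [hvw]
    simp only [φ, Finset.mem_filter, Finset.mem_univ, true_and, eq_iff_iff] at hi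
    cases hv : v i <;> cases hw : w i <;> simp_all
  set t := Int.toNat ((c + Fintype.card ι) / 2) with ht
  have himg : S.image φ ⊆ powersetCard t univ := by
    intro A hA
    rw [Finset.mem_image] at hA
    obtain ⟨v, hv, rfl⟩ := hA
    rw [hS, Finset.mem_filter] at hv
    have hsum := sum_sign_eq_card ι v
    rw [hv.2] at hsum
    rw [Finset.mem_powersetCard]
    refine ⟨Finset.subset_univ _, ?_⟩
    have hsum' : c = 2 * ((φ v).card : ℤ) - Fintype.card ι := hsum
    have h2 : ((φ v).card : ℤ) = (c + Fintype.card ι) / 2 := by omega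
    zify
    rw [h2, ht, Int.toNat_of_nonneg (by omega)]
  calc S.card = (S.image φ).card := (Finset.card_image_of_injective S hinj).symm
    _ ≤ (powersetCard t (univ : Finset ι)).card := Finset.card_le_card himg
    _ = (Fintype.card ι).choose t := by rw [Finset.card_powersetCard, Finset.card_univ]
    _ ≤ (Fintype.card ι).choose (Fintype.card ι / 2) := Nat.choose_le_middle t _

/-! ## The central binomial bound `C(j, ⌊j/2⌋) ≤ 2^j / √(j+1)` -/

theorem centralBinom_sq_mul_le (n : ℕ) :
    (n.centralBinom : ℝ) ^ 2 * (2 * n + 1) ≤ ((4 : ℝ) ^ n) ^ 2 := by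
  induction n with
  | zero => simp
  | succ n ih =>
    have hrec : ((n : ℝ) + 1) * ((n + 1).centralBinom : ℝ) = 2 * (2 * n + 1) * n.centralBinom := by
      have := Nat.succ_mul_centralBinom_succ n
      have := congr_arg (fun m : ℕ => (m : ℝ)) this
      push_cast at this
      linarith
    have hn1 : (0 : ℝ) < (n : ℝ) + 1 := by positivity
    -- multiply the goal by (n+1)^2
    have key : (((n : ℝ) + 1) * ((n + 1).centralBinom : ℝ)) ^ 2 * (2 * (n + 1 : ℕ) + 1) ≤
        (((n : ℝ) + 1) * (4 : ℝ) ^ (n + 1)) ^ 2 := by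
      rw [hrec]
      push_cast
      have hpos : (0 : ℝ) ≤ 4 * (2 * n + 1) * (2 * n + 3) := by positivity
      have h44 : (0 : ℝ) ≤ ((4 : ℝ) ^ n) ^ 2 := by positivity
      calc (2 * (2 * (n : ℝ) + 1) * n.centralBinom) ^ 2 * (2 * ((n : ℝ) + 1) + 1)
          = 4 * (2 * n + 1) * (2 * n + 3) * ((n.centralBinom : ℝ) ^ 2 * (2 * n + 1)) := by ring
        _ ≤ 4 * (2 * n + 1) * (2 * n + 3) * (((4 : ℝ) ^ n) ^ 2) := mul_le_mul_of_nonneg_left ih hpos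
        _ ≤ 16 * ((n : ℝ) + 1) ^ 2 * (((4 : ℝ) ^ n) ^ 2) := by
            apply mul_le_mul_of_nonneg_right _ h44
            nlinarith
        _ = (((n : ℝ) + 1) * (4 : ℝ) ^ (n + 1)) ^ 2 := by ring
    have h1 : (((n : ℝ) + 1) * ((n + 1).centralBinom : ℝ)) ^ 2 * (2 * (n + 1 : ℕ) + 1) =
        ((n : ℝ) + 1) ^ 2 * (((n + 1).centralBinom : ℝ) ^ 2 * (2 * (n + 1 : ℕ) + 1)) := by ring
    have h2 : (((n : ℝ) + 1) * (4 : ℝ) ^ (n + 1)) ^ 2 = ((n : ℝ) + 1) ^ 2 * ((4 : ℝ) ^ (n + 1)) ^ 2 := by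
      ring
    rw [h1, h2] at key
    exact le_of_mul_le_mul_left key (by positivity)

theorem centralBinom_le_sqrt (n : ℕ) :
    (n.centralBinom : ℝ) * Real.sqrt (2 * n + 1) ≤ (4 : ℝ) ^ n := by
  have h := centralBinom_sq_mul_le n
  have hs : Real.sqrt (2 * n + 1) ^ 2 = 2 * n + 1 := Real.sq_sqrt (by positivity)
  have : ((n.centralBinom : ℝ) * Real.sqrt (2 * n + 1)) ^ 2 ≤ ((4 : ℝ) ^ n) ^ 2 := by
    rw [mul_pow, hs]; exact h
  exact (pow_le_pow_iff_left₀ (by positivity) (by positivity) two_ne_zero).1 this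

theorem choose_middle_le (j : ℕ) :
    ((j.choose (j / 2) : ℕ) : ℝ) ≤ (2 : ℝ) ^ j / Real.sqrt (j + 1) := by
  have h4 : ∀ n : ℕ, (4 : ℝ) ^ n = (2 : ℝ) ^ (2 * n) := fun n => by
    rw [pow_mul]; norm_num
  obtain ⟨n, rfl | rfl⟩ := Nat.even_or_odd' j
  · -- j = 2n
    have hc : (2 * n).choose (2 * n / 2) = n.centralBinom := by
      rw [Nat.mul_div_cancel_left n two_pos]; rfl
    rw [hc, le_div_iff₀ (Real.sqrt_pos.2 (by positivity)), ← h4]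
    have := centralBinom_le_sqrt n
    push_cast
    exact this
  · -- j = 2n+1
    have hdiv : (2 * n + 1) / 2 = n := by omega
    have hc : ((2 * n + 1).choose n : ℝ) * (n + 1) = (2 * n + 1) * n.centralBinom := by
      have h1 := Nat.add_one_mul_choose_eq (2 * n) n
      -- (2n+1) * C(2n, n) = C(2n+1, n+1) * (n+1)
      have h2 : (2 * n + 1).choose (n + 1) = (2 * n + 1).choose n := Nat.choose_symm_half n
      rw [h2] at h1
      have := congr_arg (fun m : ℕ => (m : ℝ)) h1
      push_cast at this
      rw [Nat.centralBinom]
      linarith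
    rw [hdiv, le_div_iff₀ (Real.sqrt_pos.2 (by positivity))]
    have hcb := centralBinom_le_sqrt n
    have hn1 : (0 : ℝ) < (n : ℝ) + 1 := by positivity
    -- C(2n+1,n) √(2n+2) (n+1) = (2n+1) c √(2n+2) ≤ ... ≤ 2·4^n (n+1)
    have hs1 : Real.sqrt (2 * n + 1) * Real.sqrt (2 * n + 1) = 2 * n + 1 :=
      Real.mul_self_sqrt (by positivity)
    have hs2 : Real.sqrt (((2 * n + 1 : ℕ) : ℝ) + 1) * Real.sqrt (((2 * n + 1 : ℕ) : ℝ) + 1) = 2 * n + 2 := by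
      rw [Real.mul_self_sqrt (by positivity)]; push_cast; ring
    have hs12 : Real.sqrt (2 * n + 1) ≤ Real.sqrt (((2 * n + 1 : ℕ) : ℝ) + 1) :=
      Real.sqrt_le_sqrt (by push_cast; linarith)
    have hpos1 : 0 ≤ Real.sqrt (2 * n + 1) := Real.sqrt_nonneg _
    have hpos2 : 0 ≤ Real.sqrt (((2 * n + 1 : ℕ) : ℝ) + 1) := Real.sqrt_nonneg _
    have hcpos : (0 : ℝ) ≤ n.centralBinom := by positivity
    have hCpos : (0 : ℝ) ≤ ((2 * n + 1).choose n : ℝ) := by positivity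
    -- goal: C(2n+1,n) * √(2n+1+1) ≤ 2^(2n+1)
    have hgoal : ((2 * n + 1).choose n : ℝ) * Real.sqrt (((2 * n + 1 : ℕ) : ℝ) + 1) * ((n : ℝ) + 1) ≤
        (2 : ℝ) ^ (2 * n + 1) * ((n : ℝ) + 1) := by
      have e1 : ((2 * n + 1).choose n : ℝ) * Real.sqrt (((2 * n + 1 : ℕ) : ℝ) + 1) * ((n : ℝ) + 1) =
          (2 * n + 1) * n.centralBinom * Real.sqrt (((2 * n + 1 : ℕ) : ℝ) + 1) := by
        have := hc; nlinarith [this]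
      rw [e1, pow_succ, ← h4]
      -- (2n+1) c s₂ ≤ 4^n · 2 (n+1), using c √(2n+1) ≤ 4^n and √(2n+1) s₂ ≤ ... hmm use (2n+1) = s₁², s₁ ≤ s₂, s₂² = 2n+2
      have e2 : (2 * (n : ℝ) + 1) * n.centralBinom * Real.sqrt (((2 * n + 1 : ℕ) : ℝ) + 1) =
          (n.centralBinom * Real.sqrt (2 * n + 1)) * (Real.sqrt (2 * n + 1) * Real.sqrt (((2 * n + 1 : ℕ) : ℝ) + 1)) := by
        have e2' : (n.centralBinom : ℝ) * Real.sqrt (2 * n + 1) *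
            (Real.sqrt (2 * n + 1) * Real.sqrt (((2 * n + 1 : ℕ) : ℝ) + 1)) =
            n.centralBinom * (Real.sqrt (2 * n + 1) * Real.sqrt (2 * n + 1)) *
              Real.sqrt (((2 * n + 1 : ℕ) : ℝ) + 1) := by ring
        rw [e2', hs1]; ring
      rw [e2]
      have e3 : Real.sqrt (2 * n + 1) * Real.sqrt (((2 * n + 1 : ℕ) : ℝ) + 1) ≤ 2 * n + 2 := by
        calc Real.sqrt (2 * n + 1) * Real.sqrt (((2 * n + 1 : ℕ) : ℝ) + 1)
            ≤ Real.sqrt (((2 * n + 1 : ℕ) : ℝ) + 1) * Real.sqrt (((2 * n + 1 : ℕ) : ℝ) + 1) :=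
              mul_le_mul_of_nonneg_right hs12 hpos2
          _ = 2 * n + 2 := hs2
      calc n.centralBinom * Real.sqrt (2 * n + 1) * (Real.sqrt (2 * n + 1) * Real.sqrt (((2 * n + 1 : ℕ) : ℝ) + 1))
          ≤ (4 : ℝ) ^ n * (2 * n + 2) :=
            mul_le_mul hcb e3 (by positivity) (by positivity)
        _ = (4 : ℝ) ^ n * 2 * ((n : ℝ) + 1) := by ring
    exact le_of_mul_le_mul_right hgoal hn1

/-- For every `j` and every threshold `j₀`: `C(j, ⌊j/2⌋) ≤ 2^{j₀} + 2^j/√(j₀+1)`. -/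
theorem choose_middle_le_two_ways (j j₀ : ℕ) :
    ((j.choose (j / 2) : ℕ) : ℝ) ≤ (2 : ℝ) ^ j₀ + (2 : ℝ) ^ j / Real.sqrt (j₀ + 1) := by
  rcases le_or_gt j j₀ with h | h
  · have h1 : ((j.choose (j / 2) : ℕ) : ℝ) ≤ (2 : ℝ) ^ j := by
      exact_mod_cast Nat.choose_le_two_pow j (j / 2)
    have h2 : (2 : ℝ) ^ j ≤ (2 : ℝ) ^ j₀ := pow_le_pow_right₀ (by norm_num) h
    have h3 : (0 : ℝ) ≤ (2 : ℝ) ^ j / Real.sqrt (j₀ + 1) := by positivity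
    linarith
  · have h1 := choose_middle_le j
    have h2 : (2 : ℝ) ^ j / Real.sqrt (j + 1) ≤ (2 : ℝ) ^ j / Real.sqrt (j₀ + 1) := by
      apply div_le_div_of_nonneg_left (by positivity) (Real.sqrt_pos.2 (by positivity))
      exact Real.sqrt_le_sqrt (by exact_mod_cast Nat.succ_le_succ h.le)
    have h3 : (0 : ℝ) ≤ (2 : ℝ) ^ j₀ := by positivity
    linarith

/-! ## The inner bound: freezing the coordinates off `J` -/

section Inner

variable {N : ℕ}

/-- With the coordinates off `J` frozen, at most `C(|J|, ⌊|J|/2⌋)` sign patterns on `J` hit a given total. -/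
theorem inner_le (J : Finset (Fin N)) (r : Fin N → Bool → ℝ) (hr : ∀ i b, 0 ≤ r i b) (k : ℤ) :
    (∑ s ∈ (univ : Finset (Fin N → Bool)).filter (fun s => (∑ i, (if s i then (1 : ℤ) else -1)) = k),
        ∏ i ∈ univ \ J, r i (s i)) ≤
      ((J.card.choose (J.card / 2) : ℕ) : ℝ) * ∏ i ∈ univ \ J, (r i true + r i false) := by
  classical
  rw [Finset.sum_filter]
  set e := Equiv.piEquivPiSubtypeProd (fun i : Fin N => i ∈ J) (fun _ => Bool) with he
  -- coordinate split of the indicator-weighted sum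
  have step1 :
      (∑ s : Fin N → Bool,
          (if (∑ i, (if s i then (1 : ℤ) else -1)) = k then ∏ i ∈ univ \ J, r i (s i) else 0)) =
        ∑ v : {i // i ∈ J} → Bool, ∑ u : {i // i ∉ J} → Bool,
          (if (∑ i : {i // i ∈ J}, (if v i then (1 : ℤ) else -1)) +
                (∑ i : {i // i ∉ J}, (if u i then (1 : ℤ) else -1)) = k
            then ∏ i : {i // i ∉ J}, r i (u i) else 0) := by
    rw [← Fintype.sum_prod_type']
    refine Fintype.sum_equiv e _ _ fun s => ?_
    have hS : (∑ i, (if s i then (1 : ℤ) else -1)) =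
        (∑ i : {i // i ∈ J}, (if (e s).1 i then (1 : ℤ) else -1)) +
          ∑ i : {i // i ∉ J}, (if (e s).2 i then (1 : ℤ) else -1) := by
      rw [← Fintype.sum_subtype_add_sum_subtype (fun i : Fin N => i ∈ J)
        (fun i => if s i then (1 : ℤ) else -1)]
      congr! 1
      exact Finset.sum_congr (by ext; simp) (fun i _ => by simp [he])
    have hP : ∏ i ∈ univ \ J, r i (s i) = ∏ i : {i // i ∉ J}, r i ((e s).2 i) := by
      rw [Finset.prod_subtype (univ \ J) (p := fun i => i ∉ J) (fun x => by simp)]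
      rfl
    rw [hS, hP]
  rw [step1, Finset.sum_comm]
  -- for each frozen `u`, count the `v`'s
  have step2 : ∀ u : {i // i ∉ J} → Bool,
      (∑ v : {i // i ∈ J} → Bool,
          (if (∑ i : {i // i ∈ J}, (if v i then (1 : ℤ) else -1)) +
                (∑ i : {i // i ∉ J}, (if u i then (1 : ℤ) else -1)) = k
            then ∏ i : {i // i ∉ J}, r i (u i) else 0)) ≤
        ((J.card.choose (J.card / 2) : ℕ) : ℝ) * ∏ i : {i // i ∉ J}, r i (u i) := by
    intro u
    set bu := ∑ i : {i // i ∉ J}, (if u i then (1 : ℤ) else -1) with hbu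
    set G := ∏ i : {i // i ∉ J}, r i (u i) with hG'
    have hG : 0 ≤ G := Finset.prod_nonneg fun i _ => hr _ _
    have hrw : (∑ v : {i // i ∈ J} → Bool,
          (if (∑ i : {i // i ∈ J}, (if v i then (1 : ℤ) else -1)) + bu = k then G else 0)) =
        G * ((univ.filter fun v : {i // i ∈ J} → Bool =>
              (∑ i, (if v i then (1 : ℤ) else -1)) = k - bu).card : ℝ) := by
      rw [← Finset.sum_boole, Finset.mul_sum]
      refine Finset.sum_congr rfl fun v _ => ?_
      by_cases h : (∑ i, (if v i then (1 : ℤ) else -1)) = k - bu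
      · rw [if_pos h, if_pos (by omega), mul_one]
      · rw [if_neg h, if_neg (by omega), mul_zero]
    rw [hrw, mul_comm]
    apply mul_le_mul_of_nonneg_right _ hG
    have hc := card_signPatterns_le {i // i ∈ J} (k - bu)
    rw [Fintype.card_coe] at hc
    exact_mod_cast hc
  -- sum the frozen weights: a product of binomials
  have step3 : (∑ u : {i // i ∉ J} → Bool, ∏ i : {i // i ∉ J}, r i (u i)) =
      ∏ i : {i // i ∉ J}, (r i true + r i false) := by
    have := Finset.prod_univ_sum (fun _ : {i // i ∉ J} => (univ : Finset Bool)) fun i b => r i b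
    rw [Fintype.piFinset_univ] at this
    rw [← this]
    refine Finset.prod_congr rfl fun i _ => ?_
    exact Fintype.sum_bool _
  calc (∑ u : {i // i ∉ J} → Bool, ∑ v : {i // i ∈ J} → Bool, _)
      ≤ ∑ u : {i // i ∉ J} → Bool,
          ((J.card.choose (J.card / 2) : ℕ) : ℝ) * ∏ i : {i // i ∉ J}, r i (u i) :=
        Finset.sum_le_sum fun u _ => step2 u
    _ = ((J.card.choose (J.card / 2) : ℕ) : ℝ) * ∏ i : {i // i ∉ J}, (r i true + r i false) := by
        rw [← Finset.mul_sum, step3]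
    _ = ((J.card.choose (J.card / 2) : ℕ) : ℝ) * ∏ i ∈ univ \ J, (r i true + r i false) := by
        rw [Finset.prod_subtype (univ \ J) (p := fun i => i ∉ J) (fun x => by simp)]

end Inner

/-! ## Assembly -/

/-- Analytic tail bound: `2^{j₀} (1-ε)^N ≤ (2/ε)/(N+1)` for `j₀ = ⌊εN/2⌋₊`, `0 < ε ≤ 1/2`. -/
theorem tail_bound {ε : ℝ} (hε : 0 < ε) (hε2 : ε ≤ 1 / 2) (N : ℕ) :
    (2 : ℝ) ^ ⌊ε * N / 2⌋₊ * (1 - ε) ^ N ≤ 2 / ε / ((N : ℝ) + 1) := by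
  set j₀ := ⌊ε * N / 2⌋₊ with hj₀
  have hj₀le : (j₀ : ℝ) ≤ ε * N / 2 := Nat.floor_le (by positivity)
  have h1ε : 0 < 1 - ε := by linarith
  have hlog2 : Real.log 2 < 0.6931471808 := Real.log_two_lt_d9
  have hlog1 : Real.log (1 - ε) ≤ -ε := by
    have := Real.log_le_sub_one_of_pos h1ε; linarith
  -- write as an exponential
  have hexp : (2 : ℝ) ^ j₀ * (1 - ε) ^ N = Real.exp (j₀ * Real.log 2 + N * Real.log (1 - ε)) := by
    rw [Real.exp_add, Real.exp_nat_mul, Real.exp_nat_mul, Real.exp_log two_pos, Real.exp_log h1ε]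
  rw [hexp]
  have hexpo : (j₀ : ℝ) * Real.log 2 + N * Real.log (1 - ε) ≤ -(ε * N / 2) := by
    have hN : (0 : ℝ) ≤ N := by positivity
    have h2 : (j₀ : ℝ) * Real.log 2 ≤ ε * N / 2 * 0.6931471808 := by
      have := mul_le_mul hj₀le hlog2.le (Real.log_nonneg one_le_two) (by positivity)
      linarith
    have h3 : (N : ℝ) * Real.log (1 - ε) ≤ N * (-ε) := mul_le_mul_of_nonneg_left hlog1 hN
    nlinarith [h2, h3, hε, hN]
  calc Real.exp (j₀ * Real.log 2 + N * Real.log (1 - ε))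
      ≤ Real.exp (-(ε * N / 2)) := Real.exp_le_exp.2 hexpo
    _ ≤ 1 / (1 + ε * N / 2) := by
        rw [Real.exp_neg, one_div]
        exact inv_anti₀ (by positivity) (by linarith [Real.add_one_le_exp (ε * N / 2)])
    _ ≤ 2 / ε / ((N : ℝ) + 1) := by
        rw [div_div, div_le_div_iff₀ (by positivity) (by positivity)]
        have : (2 : ℝ) / ε ≥ 1 := by
          rw [ge_iff_le, le_div_iff₀ hε]; linarith
        nlinarith [this, hε]

/-- **S4 (`LittlewoodOfford`) holds** — verbatim the registered stub statement. -/
theorem littlewoodOfford_proof :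
    ∀ ε : ℝ, 0 < ε → ∃ C : ℝ, ∀ (N : ℕ) (p : Fin N → ℝ), (∀ i, ε ≤ p i ∧ p i ≤ 1 - ε) → ∀ k : ℤ,
      (∑ s ∈ (Finset.univ : Finset (Fin N → Bool)).filter
          (fun s => (∑ i, (if s i then (1 : ℤ) else -1)) = k),
        ∏ i, (if s i then p i else 1 - p i)) ≤ C / Real.sqrt (N + 1) := by
  intro ε hε
  refine ⟨1 + 4 / ε, fun N p hp k => ?_⟩
  classical
  -- total mass ≤ 1 (used for N = 0)
  have hw0 : ∀ (i : Fin N) (b : Bool), 0 ≤ (if b then p i else 1 - p i) := by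
    intro i b; have := hp i; cases b <;> simp <;> linarith
  rcases Nat.eq_zero_or_pos N with hN0 | hNpos
  · subst hN0
    have h4 : (0 : ℝ) ≤ 4 / ε := by positivity
    calc _ ≤ ∑ s : Fin 0 → Bool, ∏ i, (if s i then p i else 1 - p i) :=
          Finset.sum_le_sum_of_subset_of_nonneg (Finset.filter_subset _ _)
            (fun s _ _ => Finset.prod_nonneg fun i _ => hw0 i (s i))
      _ = 1 := by simp
      _ ≤ (1 + 4 / ε) / Real.sqrt ((0 : ℕ) + 1) := by
          rw [Nat.cast_zero, zero_add, Real.sqrt_one, div_one]; linarith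
  -- N ≥ 1: ε ≤ 1/2
  have hε2 : ε ≤ 1 / 2 := by
    have := hp ⟨0, hNpos⟩; linarith [this.1, this.2]
  -- residual weights
  set r : Fin N → Bool → ℝ := fun i b => (if b then p i else 1 - p i) - ε with hr
  have hr0 : ∀ i b, 0 ≤ r i b := by
    intro i b; have := hp i; cases b <;> simp [hr] <;> linarith
  have hrsum : ∀ i, r i true + r i false = 1 - 2 * ε := by
    intro i; simp [hr]; ring
  -- Step 1: expand ∏ (ε + r) over subsets J
  have hexpand : ∀ s : Fin N → Bool,
      ∏ i, (if s i then p i else 1 - p i) =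
        ∑ J ∈ (univ : Finset (Fin N)).powerset, ε ^ J.card * ∏ i ∈ univ \ J, r i (s i) := by
    intro s
    have : ∀ i, (if s i then p i else 1 - p i) = ε + r i (s i) := by
      intro i; simp [hr]
    simp_rw [this]
    rw [Finset.prod_add]
    refine Finset.sum_congr rfl fun J _ => ?_
    rw [Finset.prod_const]
  -- Step 2: exchange the sums and apply the inner bound
  have hA : (∑ s ∈ (Finset.univ : Finset (Fin N → Bool)).filter
          (fun s => (∑ i, (if s i then (1 : ℤ) else -1)) = k),
        ∏ i, (if s i then p i else 1 - p i)) ≤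
      ∑ J ∈ (univ : Finset (Fin N)).powerset,
        ε ^ J.card * (((J.card.choose (J.card / 2) : ℕ) : ℝ) * (1 - 2 * ε) ^ (N - J.card)) := by
    calc _ = ∑ s ∈ (Finset.univ : Finset (Fin N → Bool)).filter
              (fun s => (∑ i, (if s i then (1 : ℤ) else -1)) = k),
            ∑ J ∈ (univ : Finset (Fin N)).powerset, ε ^ J.card * ∏ i ∈ univ \ J, r i (s i) :=
          Finset.sum_congr rfl fun s _ => hexpand s
      _ = ∑ J ∈ (univ : Finset (Fin N)).powerset, ε ^ J.card *
            ∑ s ∈ (Finset.univ : Finset (Fin N → Bool)).filter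
              (fun s => (∑ i, (if s i then (1 : ℤ) else -1)) = k), ∏ i ∈ univ \ J, r i (s i) := by
          rw [Finset.sum_comm]
          refine Finset.sum_congr rfl fun J _ => ?_
          rw [Finset.mul_sum]
      _ ≤ _ := by
          refine Finset.sum_le_sum fun J _ => ?_
          refine mul_le_mul_of_nonneg_left ?_ (by positivity)
          have h := inner_le J r hr0 k
          have hprod : ∏ i ∈ univ \ J, (r i true + r i false) = (1 - 2 * ε) ^ (N - J.card) := by
            rw [Finset.prod_congr rfl fun i _ => hrsum i, Finset.prod_const, Finset.card_univ_sdiff,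
              Fintype.card_fin]
          rwa [hprod] at h
  -- Step 3: regroup by |J| = j
  have hregroup : (∑ J ∈ (univ : Finset (Fin N)).powerset,
        ε ^ J.card * (((J.card.choose (J.card / 2) : ℕ) : ℝ) * (1 - 2 * ε) ^ (N - J.card))) =
      ∑ j ∈ range (N + 1), (N.choose j : ℝ) *
        (ε ^ j * (((j.choose (j / 2) : ℕ) : ℝ) * (1 - 2 * ε) ^ (N - j))) := by
    have := Finset.sum_powerset_apply_card
      (fun j => ε ^ j * (((j.choose (j / 2) : ℕ) : ℝ) * (1 - 2 * ε) ^ (N - j)))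
      (x := (univ : Finset (Fin N)))
    rw [Finset.card_univ, Fintype.card_fin] at this
    rw [this]
    refine Finset.sum_congr rfl fun j _ => ?_
    rw [nsmul_eq_mul]
  -- Step 4: termwise bound with j₀
  set j₀ := ⌊ε * N / 2⌋₊ with hj₀
  have h12ε : 0 ≤ 1 - 2 * ε := by linarith
  have hterm : ∀ j ∈ range (N + 1), (N.choose j : ℝ) *
        (ε ^ j * (((j.choose (j / 2) : ℕ) : ℝ) * (1 - 2 * ε) ^ (N - j))) ≤
      (2 : ℝ) ^ j₀ * (ε ^ j * (1 - 2 * ε) ^ (N - j) * N.choose j) +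
        (1 / Real.sqrt (j₀ + 1)) * ((2 * ε) ^ j * (1 - 2 * ε) ^ (N - j) * N.choose j) := by
    intro j _
    have hcm := choose_middle_le_two_ways j j₀
    have hnn : (0 : ℝ) ≤ (N.choose j : ℝ) * ε ^ j * (1 - 2 * ε) ^ (N - j) := by positivity
    calc (N.choose j : ℝ) * (ε ^ j * (((j.choose (j / 2) : ℕ) : ℝ) * (1 - 2 * ε) ^ (N - j)))
        = ((N.choose j : ℝ) * ε ^ j * (1 - 2 * ε) ^ (N - j)) * ((j.choose (j / 2) : ℕ) : ℝ) := by ring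
      _ ≤ ((N.choose j : ℝ) * ε ^ j * (1 - 2 * ε) ^ (N - j)) *
            ((2 : ℝ) ^ j₀ + (2 : ℝ) ^ j / Real.sqrt (j₀ + 1)) := mul_le_mul_of_nonneg_left hcm hnn
      _ = _ := by rw [mul_pow]; ring
  have hsum1 : ∑ j ∈ range (N + 1), ε ^ j * (1 - 2 * ε) ^ (N - j) * (N.choose j : ℝ) = (1 - ε) ^ N := by
    rw [show (1 : ℝ) - ε = ε + (1 - 2 * ε) by ring, add_pow]
  have hsum2 : ∑ j ∈ range (N + 1), (2 * ε) ^ j * (1 - 2 * ε) ^ (N - j) * (N.choose j : ℝ) = 1 := by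
    have := add_pow (2 * ε) (1 - 2 * ε) N
    rw [show (2 : ℝ) * ε + (1 - 2 * ε) = 1 by ring, one_pow] at this
    exact this.symm
  have hB : (∑ j ∈ range (N + 1), (N.choose j : ℝ) *
        (ε ^ j * (((j.choose (j / 2) : ℕ) : ℝ) * (1 - 2 * ε) ^ (N - j)))) ≤
      (2 : ℝ) ^ j₀ * (1 - ε) ^ N + 1 / Real.sqrt (j₀ + 1) := by
    calc _ ≤ ∑ j ∈ range (N + 1), ((2 : ℝ) ^ j₀ * (ε ^ j * (1 - 2 * ε) ^ (N - j) * N.choose j) +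
          (1 / Real.sqrt (j₀ + 1)) * ((2 * ε) ^ j * (1 - 2 * ε) ^ (N - j) * N.choose j)) :=
          Finset.sum_le_sum hterm
      _ = (2 : ℝ) ^ j₀ * (1 - ε) ^ N + 1 / Real.sqrt (j₀ + 1) := by
          rw [Finset.sum_add_distrib, ← Finset.mul_sum, ← Finset.mul_sum, hsum1, hsum2, mul_one]
  -- Step 5: the two analytic bounds
  have hT := tail_bound hε hε2 N
  have hNr : (1 : ℝ) ≤ N := by exact_mod_cast hNpos
  have hsqrt_pos : 0 < Real.sqrt ((N : ℝ) + 1) := Real.sqrt_pos.2 (by positivity)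
  have hsq : Real.sqrt ((N : ℝ) + 1) ≤ (N : ℝ) + 1 := by
    rw [Real.sqrt_le_left (by positivity)]
    nlinarith
  -- (ii) tail ≤ (2/ε)/√(N+1)
  have hii : (2 : ℝ) ^ j₀ * (1 - ε) ^ N ≤ 2 / ε / Real.sqrt ((N : ℝ) + 1) :=
    hT.trans (div_le_div_of_nonneg_left (by positivity) hsqrt_pos hsq)
  -- (i) 1/√(j₀+1) ≤ (2/ε)/√(N+1)
  have hi : 1 / Real.sqrt (j₀ + 1) ≤ 2 / ε / Real.sqrt ((N : ℝ) + 1) := by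
    have hj1 : ε * N / 2 < (j₀ : ℝ) + 1 := Nat.lt_floor_add_one _
    have hkey : ε ^ 2 / 4 * ((N : ℝ) + 1) ≤ (j₀ : ℝ) + 1 := by nlinarith
    -- √(N+1) ≤ (2/ε) √(j₀+1)
    have h1 : Real.sqrt ((N : ℝ) + 1) ≤ 2 / ε * Real.sqrt (j₀ + 1) := by
      have h3 : (2 / ε) ^ 2 * (ε ^ 2 / 4 * ((N : ℝ) + 1)) = (N : ℝ) + 1 := by
        rw [div_pow, ← mul_assoc, div_mul_div_comm, show (2 : ℝ) ^ 2 * ε ^ 2 = ε ^ 2 * 4 by ring,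
          div_self (by positivity : (0 : ℝ) < ε ^ 2 * 4).ne', one_mul]
      have h2 : (N : ℝ) + 1 ≤ (2 / ε) ^ 2 * ((j₀ : ℝ) + 1) := by
        have := mul_le_mul_of_nonneg_left hkey (by positivity : (0 : ℝ) ≤ (2 / ε) ^ 2)
        linarith
      calc Real.sqrt ((N : ℝ) + 1) ≤ Real.sqrt ((2 / ε) ^ 2 * ((j₀ : ℝ) + 1)) := Real.sqrt_le_sqrt h2
        _ = 2 / ε * Real.sqrt (j₀ + 1) := by
            rw [Real.sqrt_mul (by positivity), Real.sqrt_sq (by positivity)]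
    rw [div_le_div_iff₀ (Real.sqrt_pos.2 (by positivity)) hsqrt_pos, one_mul]
    linarith
  calc _ ≤ (2 : ℝ) ^ j₀ * (1 - ε) ^ N + 1 / Real.sqrt (j₀ + 1) := (hA.trans (le_of_eq hregroup)).trans hB
    _ ≤ 2 / ε / Real.sqrt ((N : ℝ) + 1) + 2 / ε / Real.sqrt ((N : ℝ) + 1) := add_le_add hii hi
    _ = (4 / ε) / Real.sqrt ((N : ℝ) + 1) := by ring
    _ ≤ (1 + 4 / ε) / Real.sqrt (N + 1) := by
        apply div_le_div_of_nonneg_right _ hsqrt_pos.le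
        linarith

end LittlewoodOffordProof

/-! ## In the skeleton's scope (`open scoped Classical` as in `Lines/free-volume-heavy-witness.lean`):
the registered statement, closed by `exact`. -/
section SkeletonScope

open scoped BigOperators Topology Classical ENNReal

/-- Verbatim `LittlewoodOfford` / `stub_littlewoodOfford` of the skeleton, in the skeleton's `open scoped` context. -/
theorem stub_littlewoodOfford_candidate :
    ∀ ε : ℝ, 0 < ε → ∃ C : ℝ, ∀ (N : ℕ) (p : Fin N → ℝ), (∀ i, ε ≤ p i ∧ p i ≤ 1 - ε) → ∀ k : ℤ,
      (∑ s ∈ (Finset.univ : Finset (Fin N → Bool)).filter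
          (fun s => (∑ i, (if s i then (1 : ℤ) else -1)) = k),
        ∏ i, (if s i then p i else 1 - p i)) ≤ C / Real.sqrt (N + 1) :=
  LittlewoodOffordProof.littlewoodOfford_proof

end SkeletonScope
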